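import Literature.NumberTheory.Sieve.BombieriFriedlanderIwaniecTheorem9Interior
import Literature.NumberTheory.Sieve.BombieriFriedlanderIwaniecAssembly
import Literature.NumberTheory.Sieve.ShiuBrunTitchmarshProofs
import Literature.NumberTheory.Sieve.ShiuTheoremProofs
import Literature.NumberTheory.LFunctions.SiegelWalfiszMoebiusProofs
import Literature.NumberTheory.Sieve.SieveFrameworkFundamentalLemma
import HarnessLib

/-!
# Bombieri–Friedlander–Iwaniec 1986, Theorem 9 from Theorems 6 and 7* (the DAG closed)

Topic `Literature/NumberTheory/Sieve`, the top of the DAG under the named fact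
`Literature.NumberTheory.Sieve.BombieriFriedlanderIwaniecTheorem9` (E. Bombieri, J. B. Friedlander,
H. Iwaniec, *Primes in arithmetic progressions to large moduli*, Acta Math. 156 (1986), 203–251,
§1 Theorem 9, p. 209).  Everything here is PROVED; no named fact is introduced.

* `BFI.sifted_sum_bound9` — the sifted signed dyadic estimate (15.1) for the moduli `qr` of
  Theorem 9, assembled as `BFI.sifted_sum_bound` (Theorem 10): Heath-Brown's identity, the boxes
  `Δ = ℒ^{−A₁}`, the skeleton `BFI.abstract_piece_sum_bound'` over the pairs `(r, q)`, the trivial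
  parts (`…Theorem9Errors`) and the interior tuples (`BFI.interior_tuple_bound9`);
* `BombieriFriedlanderIwaniecTheorem9_of_theorem6_theorem7Star` — **Theorem 9 is conditional exactly on
  the named facts `BombieriFriedlanderIwaniecTheorem6` (§13) and `BombieriFriedlanderIwaniecTheorem7Star`
  (§14)**, the two appeals of its printed proof (§16, p. 250) to the Deshouillers–Iwaniec bounds;
  BFI Lemma 3, Shiu's theorem, Siegel–Walfisz for `μ`, the fundamental lemma and the prime number
  theorem are theorems of the tree, and the passage to `ψ(x; qr, a) − x/φ(qr)` is
  `BombieriFriedlanderIwaniecTheorem9.of_sifted` (`…Theorem9Dyadic`).  When `…Theorem6_holds` and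
  `…Theorem7Star_holds` exist, `BombieriFriedlanderIwaniecTheorem9_holds` is one application.

## References

* E. Bombieri, J. B. Friedlander, H. Iwaniec, *Primes in arithmetic progressions to large moduli*,
  Acta Math. 156 (1986), 203–251: §1 Theorem 9 p. 209; §2 Lemma 3 p. 211; §14 pp. 244–246;
  §15 pp. 244–246; §16 p. 250. [BombieriFriedlanderIwaniecActa1986]
* P. Shiu, *A Brun–Titchmarsh theorem for multiplicative functions*, J. reine angew. Math. 313
  (1980), 161–170, Theorem 1. [Shiu1980]
-/

open Finset Real Filter

namespace Literature.NumberTheory.Sieve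

namespace BFI

/-! ### The sifted signed dyadic estimate for pairs of moduli, assembled -/

set_option maxHeartbeats 1600000 in -- the assembly of §16 with ~60 hypotheses
/-- **The sifted signed dyadic estimate for the moduli `qr` of Theorem 9** (BFI (15.1), p. 244, in
the setting of §16, p. 250), for `0 < ε ≤ 1/100`: for `a ≠ 0`, `A > 0` there are `B, C, x₀` with
`|∑_{r ≤ R,(r,a)=1} δ_r ∑_{q ≤ Q,(q,a)=1} E_z(x; qr, a)| ≤ C x (log x)^{−A}` for all `x ≥ x₀`,
`R < x^{1/10−ε}`, `QR < xℒ^{−B}`, real `|δ| ≤ 1`, `z = exp(√log x)` — assembled exactly as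
`BFI.sifted_sum_bound` for Theorem 10: Heath-Brown's identity (`dyadDiscSifted_eq_sum_hbPiece`), the
boxes (`sievedDisc_hbPiece_eq`, `Δ = ℒ^{−A₁}`), the finite-sum skeleton over the pairs `(r, q)`
(`abstract_piece_sum_bound'`), the trivial parts (`sum_abs_sievedDisc_prodErr_pairs_le`,
`sum_abs_sievedDisc_prodMain_not_interior_pairs_le`, with BFI Lemma 3 and Shiu's theorem being
theorems of the tree) and the interior tuples (`interior_tuple_bound9`: **Theorems 6 and 7***, the
Siegel–Walfisz theorem for `μ` and the fundamental lemma being theorems of the tree).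
[cite: BombieriFriedlanderIwaniecActa1986, §15 (15.1) p. 244; §16 p. 250] -/
theorem sifted_sum_bound9
    (h6 : BombieriFriedlanderIwaniecTheorem6) (h7 : BombieriFriedlanderIwaniecTheorem7Star)
    {a : ℤ} (ha : a ≠ 0) {ε : ℝ} (hε : 0 < ε) (hε' : ε ≤ 1 / 100) {A : ℝ} (hA : 0 < A) :
    ∃ B C x₀ : ℝ, ∀ x : ℝ, x₀ ≤ x → ∀ Q R : ℝ,
      R < x ^ (1 / 10 - ε) → Q * R < x / Real.log x ^ B → ∀ δ : ℕ → ℝ, (∀ r, |δ r| ≤ 1) →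
        |∑ r ∈ (Icc 1 ⌊R⌋₊).filter (fun r : ℕ => IsCoprime (r : ℤ) a),
            δ r * ∑ q ∈ (Icc 1 ⌊Q⌋₊).filter (fun q : ℕ => IsCoprime (q : ℤ) a),
              dyadDiscSifted (q * r) a (Real.exp (Real.sqrt (Real.log x))) x| ≤ C * x / Real.log x ^ A := by
  obtain ⟨BE, CE, xE, hBE, hCE, hErr⟩ := sum_abs_sievedDisc_prodErr_pairs_le BombieriFriedlanderIwaniecLemma3_holds ha
  obtain ⟨BN, CN, xN, hBN, hCN, hNI⟩ := sum_abs_sievedDisc_prodMain_not_interior_pairs_le Shiu1980BrunTitchmarsh_holds a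
  set A₁ : ℝ := A + max BE BN + 3 with hA₁
  have hA₁1 : 1 ≤ A₁ := by rw [hA₁]; have := le_max_left BE BN; linarith
  set A₅ : ℝ := A + 14 * (A₁ + 1) + 3 with hA₅
  have hA₅0 : 0 ≤ A₅ := by rw [hA₅]; linarith
  obtain ⟨B, CI, xI, hB0, hCI, hI⟩ := interior_tuple_bound9 h6 h7 BombieriFriedlanderIwaniecLemma3_holds
    Shiu1980BrunTitchmarsh_holds LFunctions.SiegelWalfiszMoebius_holds
    SieveSequence.fundamental_lemma_uniform_holds ha hε hε' hA₅0
  obtain ⟨xP, hP⟩ := eventually_params hA₁1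
  refine ⟨B, 7 * 35 * (2 * 5 ^ 14 * CI + 2 * CN + CE), max xE (max xN (max xI (max xP (Real.exp 112)))),
    fun x hx Q R hRx hQR δ hδ => ?_⟩
  have hxE : xE ≤ x := le_trans (le_max_left _ _) hx
  have hxN : xN ≤ x := le_trans ((le_max_left _ _).trans (le_max_right _ _)) hx
  have hxI : xI ≤ x := le_trans ((le_max_left _ _).trans ((le_max_right _ _).trans (le_max_right _ _))) hx
  have hxP : xP ≤ x :=
    le_trans ((le_max_left _ _).trans ((le_max_right _ _).trans ((le_max_right _ _).trans (le_max_right _ _)))) hx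
  have hx112 : Real.exp 112 ≤ x :=
    le_trans ((le_max_right _ _).trans ((le_max_right _ _).trans ((le_max_right _ _).trans (le_max_right _ _)))) hx
  obtain ⟨hx2, hL1, hlog2x, hΔ0, hΔ28, hΔx, hU1, hU4, hU7, hKpow, hKle⟩ := hP x hxP
  set L : ℝ := Real.log x with hL
  set Δ : ℝ := L ^ (-A₁) with hΔ
  set U : ℕ := 2 * ⌈x ^ (1 / 7 : ℝ)⌉₊ with hU
  set K : ℕ := ⌊2 * Real.log (2 * x) / Δ⌋₊ + 1 with hK
  set z : ℝ := Real.exp (Real.sqrt L) with hz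
  have hx0 : 0 < x := by linarith
  have hx1 : (1 : ℝ) ≤ x := by linarith
  have hL0 : 0 < L := by linarith
  have hL112 : 112 ≤ L := by rw [hL, Real.le_log_iff_exp_le hx0]; exact hx112
  have hΔ1 : Δ ≤ 1 := by linarith
  have hΔhalf : Δ ≤ 1 / 2 := by linarith
  have hΔ112 : 112 * Δ ≤ 1 := by
    have h1 : Δ ≤ L ^ (-(1 : ℝ)) := Real.rpow_le_rpow_of_exponent_le hL1 (by linarith)
    rw [Real.rpow_neg hL0.le, Real.rpow_one] at h1
    calc 112 * Δ ≤ 112 * L⁻¹ := by linarith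
      _ ≤ 1 := by rw [← div_eq_mul_inv, div_le_one hL0]; exact hL112
  have hΔ14 : (1 + Δ) ^ 14 ≤ 2 := one_add_pow_le_two hΔ0.le (by push_cast; linarith)
  have hRHS0 : 0 ≤ 7 * 35 * (2 * 5 ^ 14 * CI + 2 * CN + CE) * x / Real.log x ^ A := by
    rw [← hL]; positivity
  -- degenerate ranges: no `r` or no `q`
  by_cases hR1 : R < 1
  · have : ⌊R⌋₊ = 0 := Nat.floor_eq_zero.2 (by linarith)
    rw [this]; simpa using hRHS0
  by_cases hQ1 : Q < 1
  · have : ⌊Q⌋₊ = 0 := Nat.floor_eq_zero.2 (by linarith)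
    rw [this]; simpa using hRHS0
  push Not at hR1 hQ1
  set SR : Finset ℕ := (Icc 1 ⌊R⌋₊).filter (fun r : ℕ => IsCoprime (r : ℤ) a) with hSR
  set SQ : Finset ℕ := (Icc 1 ⌊Q⌋₊).filter (fun q : ℕ => IsCoprime (q : ℤ) a) with hSQ
  -- sizes of `Q`, `R`
  have hLB0 : 0 < L ^ B := Real.rpow_pos_of_pos hL0 _
  have hQRx : Q * R < x := by
    refine hQR.trans_le ?_
    rw [div_le_iff₀ hLB0]
    have : 1 ≤ L ^ B := Real.one_le_rpow hL1 hB0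
    nlinarith
  have hQx : (⌊Q⌋₊ : ℝ) ≤ x := (Nat.floor_le (by linarith)).trans (by nlinarith)
  have hRx' : (⌊R⌋₊ : ℝ) ≤ x := (Nat.floor_le (by linarith)).trans (by nlinarith)
  have hLc0 : 0 ≤ Real.log (2 * x) := Real.log_nonneg (by linarith)
  -- the pair sum over the product set
  set F : Finset (ℕ × ℕ) := SR ×ˢ SQ with hF
  set lam : ℕ × ℕ → ℝ := fun p => δ p.1 with hlam
  have hlam1 : ∀ p, |lam p| ≤ 1 := fun p => hδ p.1
  have hpair : ∀ X : ℕ → ℝ, ∑ r ∈ SR, δ r * ∑ q ∈ SQ, X (q * r) = ∑ p ∈ F, lam p * X (p.2 * p.1) :=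
    fun X => pairSum_eq_sum_product SR SQ δ X
  -- Heath-Brown's identity
  have hHB : ∀ d, dyadDiscSifted d a z x =
      ∑ j ∈ Icc 1 7, (-1 : ℝ) ^ (j + 1) * (Nat.choose 7 j : ℝ) * sievedDisc (fun n => hbPiece U j n) d a z x :=
    fun d => dyadDiscSifted_eq_sum_hbPiece hU7 d a z
  have hexp : ∑ p ∈ F, lam p * dyadDiscSifted (p.2 * p.1) a z x =
      ∑ j ∈ Icc 1 7, (-1 : ℝ) ^ (j + 1) * (Nat.choose 7 j : ℝ) *
        ∑ p ∈ F, lam p * sievedDisc (fun n => hbPiece U j n) (p.2 * p.1) a z x := by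
    calc ∑ p ∈ F, lam p * dyadDiscSifted (p.2 * p.1) a z x
        = ∑ p ∈ F, ∑ j ∈ Icc 1 7, (-1 : ℝ) ^ (j + 1) * (Nat.choose 7 j : ℝ) *
            (lam p * sievedDisc (fun n => hbPiece U j n) (p.2 * p.1) a z x) := by
          refine Finset.sum_congr rfl fun p _ => ?_
          rw [hHB (p.2 * p.1), Finset.mul_sum]
          exact Finset.sum_congr rfl fun j _ => by ring
      _ = _ := by
          rw [Finset.sum_comm]
          exact Finset.sum_congr rfl fun j _ => by rw [Finset.mul_sum]
  -- the per-`j` bound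
  have hperj : ∀ j ∈ Icc 1 7, |∑ p ∈ F, lam p * sievedDisc (fun n => hbPiece U j n) (p.2 * p.1) a z x| ≤
      (2 * 5 ^ 14 * CI + 2 * CN + CE) * x / L ^ A := by
    intro j hj
    rw [Finset.mem_Icc] at hj
    have hS : ∀ p ∈ F, sievedDisc (fun n => hbPiece U j n) (p.2 * p.1) a z x =
        ∑ κ ∈ tuples j K, (tupleConst x Δ j κ * sievedDisc (fun n => prodMain x z Δ U j κ n) (p.2 * p.1) a z x +
          sievedDisc (fun n => prodErr x z Δ U j κ n) (p.2 * p.1) a z x) :=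
      fun p _ => sievedDisc_hbPiece_eq hj.1 hx0 hΔ0 hKpow (p.2 * p.1) a
    -- interior tuples: back to the nested pair sum, then Theorems 6 / 7*
    have hInt : ∀ κ ∈ tuples j K, Interior x Δ j κ →
        |∑ p ∈ F, lam p * sievedDisc (fun n => prodMain x z Δ U j κ n) (p.2 * p.1) a z x| ≤
          CI * x / Real.log x ^ A₅ := by
      intro κ hκ hIntκ
      rw [← hpair (fun d => sievedDisc (fun n => prodMain x z Δ U j κ n) d a z x)]
      exact hI x hxI Δ U j K κ Q R δ hδ hQ1 hR1 hRx hQR hj.1 hj.2 hΔ0 hΔhalf hΔ14 hU1 hU4 hκ hIntκ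
    -- non-interior tuples and error products: enlarge the pair ranges
    have hN : ∑ p ∈ F, ∑ κ ∈ (tuples j K).filter (fun κ => ¬ Interior x Δ j κ),
        |sievedDisc (fun n => prodMain x z Δ U j κ n) (p.2 * p.1) a z x| ≤ CN * Δ * x * L ^ BN := by
      refine (sum_product_filter_le (fun r : ℕ => IsCoprime (r : ℤ) a) (fun q : ℕ => IsCoprime (q : ℤ) a)
        (f := fun p : ℕ × ℕ => ∑ κ ∈ (tuples j K).filter (fun κ => ¬ Interior x Δ j κ),
          |sievedDisc (fun n => prodMain x z Δ U j κ n) (p.2 * p.1) a z x|)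
        (fun p => Finset.sum_nonneg fun _ _ => abs_nonneg _)).trans ?_
      exact hNI x hxN z Δ U j K ⌊Q⌋₊ ⌊R⌋₊ hj.1 hj.2 hΔx hΔ112 hQx hRx'
    have hE : ∑ p ∈ F, ∑ κ ∈ tuples j K, |sievedDisc (fun n => prodErr x z Δ U j κ n) (p.2 * p.1) a z x| ≤
        CE * Δ * x * L ^ BE := by
      refine (sum_product_filter_le (fun r : ℕ => IsCoprime (r : ℤ) a) (fun q : ℕ => IsCoprime (q : ℤ) a)
        (f := fun p : ℕ × ℕ => ∑ κ ∈ tuples j K, |sievedDisc (fun n => prodErr x z Δ U j κ n) (p.2 * p.1) a z x|)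
        (fun p => Finset.sum_nonneg fun _ _ => abs_nonneg _)).trans ?_
      exact hErr x hxE z Δ U j K ⌊Q⌋₊ ⌊R⌋₊ hj.1 hj.2 hΔ0 hΔ1 hQx hRx'
    have hkey := abstract_piece_sum_bound' F (tuples j K) (Interior x Δ j) lam
      (fun p => sievedDisc (fun n => hbPiece U j n) (p.2 * p.1) a z x)
      (fun κ p => sievedDisc (fun n => prodMain x z Δ U j κ n) (p.2 * p.1) a z x)
      (fun κ p => sievedDisc (fun n => prodErr x z Δ U j κ n) (p.2 * p.1) a z x)
      (tupleConst x Δ j) hlam1 hS (fun κ _ => tupleConst_nonneg κ)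
      (fun κ _ => tupleConst_le (by linarith) hΔ0.le κ) hLc0 hInt
      (div_nonneg (mul_nonneg hCI hx0.le) (Real.rpow_nonneg hL0.le _)) hN hE
    refine hkey.trans ?_
    -- the number of tuples
    have hTc : ((tuples j K).card : ℝ) ≤ 5 ^ 14 * L ^ (14 * (A₁ + 1)) := by
      have hcard : (tuples j K).card = K ^ (2 * j) := by
        unfold tuples; rw [Fintype.card_piFinset, Finset.prod_const, Finset.card_range, Finset.card_univ,
          Fintype.card_fin]
      rw [hcard]
      push_cast
      have hK1 : (1 : ℝ) ≤ K := by
        rw [hK]; push_cast; have := Nat.cast_nonneg (α := ℝ) ⌊2 * Real.log (2 * x) / Δ⌋₊; linarith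
      calc (K : ℝ) ^ (2 * j) ≤ (K : ℝ) ^ 14 := pow_le_pow_right₀ hK1 (by omega)
        _ ≤ (5 * L ^ (A₁ + 1)) ^ 14 := pow_le_pow_left₀ (by linarith) hKle 14
        _ = 5 ^ 14 * (L ^ (A₁ + 1)) ^ (14 : ℕ) := mul_pow _ _ _
        _ = 5 ^ 14 * L ^ (14 * (A₁ + 1)) := by
            rw [← Real.rpow_natCast (L ^ (A₁ + 1)) 14, ← Real.rpow_mul hL0.le]; ring_nf
    exact perj_algebra hL1 hx0.le hCI hCN hCE hTc hLc0 hlog2x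
  -- sum over `j`
  rw [hpair (fun d => dyadDiscSifted d a z x), hexp]
  calc |∑ j ∈ Icc 1 7, (-1 : ℝ) ^ (j + 1) * (Nat.choose 7 j : ℝ) *
          ∑ p ∈ F, lam p * sievedDisc (fun n => hbPiece U j n) (p.2 * p.1) a z x|
      ≤ ∑ j ∈ Icc 1 7, |(-1 : ℝ) ^ (j + 1) * (Nat.choose 7 j : ℝ) *
          ∑ p ∈ F, lam p * sievedDisc (fun n => hbPiece U j n) (p.2 * p.1) a z x| := Finset.abs_sum_le_sum_abs _ _
    _ ≤ ∑ j ∈ Icc 1 7, 35 * ((2 * 5 ^ 14 * CI + 2 * CN + CE) * x / L ^ A) := by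
        refine Finset.sum_le_sum fun j hj => ?_
        rw [abs_mul, abs_mul, abs_pow, abs_neg, abs_one, one_pow, one_mul, Nat.abs_cast]
        exact mul_le_mul (choose_seven_le j) (hperj j hj) (abs_nonneg _) (by norm_num)
    _ = 7 * 35 * (2 * 5 ^ 14 * CI + 2 * CN + CE) * x / Real.log x ^ A := by
        rw [Finset.sum_const, Nat.card_Icc, nsmul_eq_mul]; push_cast; rw [← hL]; ring

end BFI

open BFI

/-! ### Theorem 9 from Theorems 6 and 7* -/

/-- **The sifted signed dyadic estimate for pairs, all `ε`** (for `ε > 1/100` the range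
`R < x^{1/10−ε}` is contained in `R < x^{1/10−1/100}`). [folklore] -/
theorem BFI.sifted_sum_bound9' (h6 : BombieriFriedlanderIwaniecTheorem6)
    (h7 : BombieriFriedlanderIwaniecTheorem7Star) {a : ℤ} (ha : a ≠ 0) {ε : ℝ} (hε : 0 < ε) {A : ℝ}
    (hA : 0 < A) :
    ∃ B C x₀ : ℝ, ∀ x : ℝ, x₀ ≤ x → ∀ Q R : ℝ,
      R < x ^ (1 / 10 - ε) → Q * R < x / Real.log x ^ B → ∀ δ : ℕ → ℝ, (∀ r, |δ r| ≤ 1) →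
        |∑ r ∈ (Icc 1 ⌊R⌋₊).filter (fun r : ℕ => IsCoprime (r : ℤ) a),
            δ r * ∑ q ∈ (Icc 1 ⌊Q⌋₊).filter (fun q : ℕ => IsCoprime (q : ℤ) a),
              dyadDiscSifted (q * r) a (Real.exp (Real.sqrt (Real.log x))) x| ≤ C * x / Real.log x ^ A := by
  set ε' : ℝ := min ε (1 / 100) with hε'def
  have hε'0 : 0 < ε' := lt_min hε (by norm_num)
  have hε'1 : ε' ≤ 1 / 100 := min_le_right _ _
  have hε'ε : ε' ≤ ε := min_le_left _ _
  obtain ⟨B, C, x₀, h⟩ := sifted_sum_bound9 h6 h7 ha hε'0 hε'1 hA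
  refine ⟨B, C, max x₀ 1, fun x hx Q R hR hQR δ hδ => ?_⟩
  have hx₀ : x₀ ≤ x := le_trans (le_max_left _ _) hx
  have hx1 : (1 : ℝ) ≤ x := le_trans (le_max_right _ _) hx
  refine h x hx₀ Q R (hR.trans_le ?_) hQR δ hδ
  exact Real.rpow_le_rpow_of_exponent_le hx1 (by linarith)

/-- **Bombieri–Friedlander–Iwaniec 1986, Theorem 9 from Theorems 6 and 7*** (§16, p. 250: "The proof
is much the same as that of Theorem 8; the difference is that we appeal to Theorems 6 and 7* instead
of 1, 2, 3, 4 and 5*"): the named fact `BombieriFriedlanderIwaniecTheorem9` — the mean value theorem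
for primes in progressions to the moduli `qr`, `R < x^{1/10−ε}`, `QR < xℒ^{−B}` (§1, p. 209) — is
CONDITIONAL exactly on the two named facts `BombieriFriedlanderIwaniecTheorem6` (§13, Theorem 6,
p. 244) and `BombieriFriedlanderIwaniecTheorem7Star` (§14, Theorem 7*, p. 246), the two places where
its printed proof invokes the Deshouillers–Iwaniec bounds for sums of Kloosterman sums; everything
else in §§15–16 (Heath-Brown's identity, the boxes, the fundamental lemma, BFI Lemma 3, Shiu's
theorem, the Siegel–Walfisz theorem for `μ`, the prime number theorem, and the passage from the
sifted dyadic discrepancies to `ψ(x; qr, a) − x/φ(qr)`) being theorems of the tree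
(`BFI.sifted_sum_bound9`, `BombieriFriedlanderIwaniecTheorem9.of_sifted`).
[cite: BombieriFriedlanderIwaniecActa1986, §1 Theorem 9 p. 209; §16 p. 250] -/
theorem BombieriFriedlanderIwaniecTheorem9_of_theorem6_theorem7Star
    (h6 : BombieriFriedlanderIwaniecTheorem6) (h7 : BombieriFriedlanderIwaniecTheorem7Star) :
    BombieriFriedlanderIwaniecTheorem9 := by
  refine BombieriFriedlanderIwaniecTheorem9.of_sifted (z := fun x => Real.exp (Real.sqrt (Real.log x))) ?_
    fun a ha ε hε A hA => BFI.sifted_sum_bound9' h6 h7 ha hε hA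
  filter_upwards [Filter.eventually_ge_atTop (Real.exp 1)] with x hx
  have hx0 : 0 < x := (Real.exp_pos 1).trans_le hx
  have hL1 : 1 ≤ Real.log x := by rwa [Real.le_log_iff_exp_le hx0]
  have hsq : Real.sqrt (Real.log x) ≤ Real.log x := by
    rw [Real.sqrt_le_left (by linarith)]
    nlinarith
  calc Real.exp (Real.sqrt (Real.log x)) ≤ Real.exp (Real.log x) := Real.exp_le_exp.2 hsq
    _ = x := Real.exp_log hx0

end Literature.NumberTheory.Sieve
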